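/-
Copyright (c) 2026 The decomp-a2c cell. All rights reserved.
Released under Apache 2.0 license as described in the file LICENSE.
-/
import Summits.AtomisticToContinuum.Crystallization.Theorems.ChartedZeroExcessLayeredLatticeLiouvilleWB

/-!
# ChartedZeroExcessLayeredLatticeLiouville — part WC «ColumnFlux»: the column flux of a GENERAL field and its divergence identity
  (decomp-a2c-lens-2, g58; helper of stmt-AtomisticToContinuum-26636, leaf (LD′) `ModalLipschitzZ`; brick (4a) `ModalLipschitzAt`, vertical half (4a⊥),
  step (F) of memo NODE-g58c)

VO–VP developed the CHAIN FLUX of a layer-only profile; the vertical half of the modal-Lipschitz estimate needs the same calculus for an arbitrary field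
`ψ : Cell 2 → ℤ → E3` (a harmonic field or one of its in-plane differences), COLUMN BY COLUMN:
* `siteFlux ψ X β = Σ_δ nearK X (δ, β) (ψ δ β − ψ X)` is the total linearised force exerted on the site `X` by the layer `β` (`truncResidual ψ X = Σ_β siteFlux`,
  `truncResidual_eq_sum_siteFlux`); it splits as the CHAIN block applied to the vertical increment of the column of `X` plus the PLANAR flux
  `planarFlux ψ X β = Σ_δ nearK X (δ, β) (ψ δ β − ψ X.1 β)` of the in-plane differences inside the layer `β` (`siteFlux_eq_chainK_add`);
* `colFlux T ψ γ m = Σ_{α ∈ T, α ≤ m} Σ_{β ∈ T, m < β} siteFlux ψ (γ, α) β` is the flux through the gap above layer `m` received by the column `γ`; it is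
  VO's `chainFlux` of the column profile `ψ γ` — hence VP's banded `fluxBlock` operator on the column's vertical increments — plus the column's planar flux
  `colPlanar` (`colFlux_eq_blockApply_add`);
* ★ THE DIVERGENCE IDENTITY `colFlux_sub_colFlux_of_residual`: if `ψ` is harmonic at `(γ, m)` then
  `colFlux T ψ γ m − colFlux T ψ γ (m−1) = −Σ_{β ∈ T, β < m} (siteFlux ψ (γ,m) β + siteFlux ψ (γ,β) m) − siteFlux ψ (γ,m) m`,
  and bond reversal + in-plane point reflection about the column (`siteFlux_reflect`) turn each pair into a sum of PARALLELOGRAM (mixed vertical/in-plane)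
  differences and in-plane SECOND differences of `ψ` (`siteFlux_add_siteFlux_eq_sum`, `two_smul_siteFlux_self_eq_sum`): the discrete form of
  `∂_z σ_zz = −div_x σ_xz`, the source of the single-gap equidistribution of the vertical increments (steps (SG), (V1), (V2) of the memo).
-/

namespace Summit.AtomisticToContinuum.Crystallization.Theorems.ChartedZeroExcessLayeredLatticeLiouville

open Summit.AtomisticToContinuum.Crystallization.Theorems.ChartedPlanarOrderRigidityDoor (E3)
open Finset
open scoped InnerProductSpace RealInnerProductSpace BigOperators

noncomputable section ColumnFlux

variable {c : ℝ} {a b : E3} {w : ℤ → E3}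

/-! ### WC.1  In-plane finsums of the truncated kernel as finite sums -/

/-- an in-plane `finsum` of truncated bonds into the layer `β` as a FINITE sum over the `β`-fibre of any finset containing the `ϱ`-near sites of `X`
(VI `chainK_eq_sum` with a site-dependent argument). [formal bookkeeping] -/
theorem finsum_nearK_eq_sum {ϱ : ℝ} {X : Cell 2 × ℤ} {N : Finset (Cell 2 × ℤ)}
    (hN : ∀ Y : Cell 2 × ℤ, ‖lsite a b w Y.1 Y.2 - lsite a b w X.1 X.2‖ ≤ ϱ → Y ∈ N) (β : ℤ) (u : Cell 2 → E3) :
    ∑ᶠ δ : Cell 2, nearK ϱ a b w X (δ, β) (u δ) = ∑ Y ∈ N with Y.2 = β, nearK ϱ a b w X Y (u Y.1) := by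
  have hsupp : (Function.support fun δ : Cell 2 => nearK ϱ a b w X (δ, β) (u δ)) ⊆ ((N.filter fun Y => Y.2 = β).image Prod.fst : Finset (Cell 2)) := by
    intro δ hδ
    rw [Function.mem_support] at hδ
    have hle : ‖lsite a b w δ β - lsite a b w X.1 X.2‖ ≤ ϱ := not_lt.mp fun h => hδ (nearK_eq_zero_of_lt (X := X) (Y := (δ, β)) h (u δ))
    rw [coe_image, coe_filter]
    exact ⟨(δ, β), ⟨hN (δ, β) hle, rfl⟩, rfl⟩
  have hinj : Set.InjOn Prod.fst ((N.filter fun Y => Y.2 = β : Finset (Cell 2 × ℤ)) : Set (Cell 2 × ℤ)) := by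
    intro Y hY Y' hY' h
    rw [coe_filter] at hY hY'
    exact Prod.ext h (hY.2.trans hY'.2.symm)
  rw [finsum_eq_sum_of_support_subset _ hsupp, sum_image hinj]
  refine sum_congr rfl fun Y hY => ?_
  have hY2 : Y.2 = β := (mem_filter.mp hY).2
  rw [← hY2]

/-- the finset of `ϱ`-near sites of `X` (US `finite_near_lsite`) contains the near sites. [formal bookkeeping] -/
theorem mem_nearFinset_of_le (hc : 0 < c) (hL : IsLayeredCrystal c a b w) (ϱ : ℝ) (X : Cell 2 × ℤ) :
    ∀ Y : Cell 2 × ℤ, ‖lsite a b w Y.1 Y.2 - lsite a b w X.1 X.2‖ ≤ ϱ → Y ∈ (finite_near_lsite hc hL X ϱ).toFinset :=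
  fun _ hY => (finite_near_lsite hc hL X ϱ).mem_toFinset.mpr hY

/-! ### WC.2  The site flux and the planar flux -/

/-- the SITE FLUX: the total linearised force exerted on the site `X` by the layer `β`, `Σ_δ nearK X (δ, β) (ψ δ β − ψ X)` (the layer-`β` part of the
truncated residual at `X`). [this file, g58] -/
def siteFlux (ϱ : ℝ) (a b : E3) (w : ℤ → E3) (ψ : Cell 2 → ℤ → E3) (X : Cell 2 × ℤ) (β : ℤ) : E3 :=
  ∑ᶠ δ : Cell 2, nearK ϱ a b w X (δ, β) (ψ δ β - ψ X.1 X.2)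

/-- the PLANAR FLUX: the force exerted on `X` by the in-plane differences of `ψ` inside the layer `β`, relative to the site of that layer in the column of `X`,
`Σ_δ nearK X (δ, β) (ψ δ β − ψ X.1 β)`. [this file, g58] -/
def planarFlux (ϱ : ℝ) (a b : E3) (w : ℤ → E3) (ψ : Cell 2 → ℤ → E3) (X : Cell 2 × ℤ) (β : ℤ) : E3 :=
  ∑ᶠ δ : Cell 2, nearK ϱ a b w X (δ, β) (ψ δ β - ψ X.1 β)

/-- the site flux as a finite sum. [formal bookkeeping] -/
theorem siteFlux_eq_sum {ϱ : ℝ} {X : Cell 2 × ℤ} {N : Finset (Cell 2 × ℤ)}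
    (hN : ∀ Y : Cell 2 × ℤ, ‖lsite a b w Y.1 Y.2 - lsite a b w X.1 X.2‖ ≤ ϱ → Y ∈ N) (ψ : Cell 2 → ℤ → E3) (β : ℤ) :
    siteFlux ϱ a b w ψ X β = ∑ Y ∈ N with Y.2 = β, nearK ϱ a b w X Y (ψ Y.1 Y.2 - ψ X.1 X.2) := by
  rw [siteFlux, finsum_nearK_eq_sum hN β fun δ => ψ δ β - ψ X.1 X.2]
  exact sum_congr rfl fun Y hY => by rw [(mem_filter.mp hY).2]

/-- the planar flux as a finite sum. [formal bookkeeping] -/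
theorem planarFlux_eq_sum {ϱ : ℝ} {X : Cell 2 × ℤ} {N : Finset (Cell 2 × ℤ)}
    (hN : ∀ Y : Cell 2 × ℤ, ‖lsite a b w Y.1 Y.2 - lsite a b w X.1 X.2‖ ≤ ϱ → Y ∈ N) (ψ : Cell 2 → ℤ → E3) (β : ℤ) :
    planarFlux ϱ a b w ψ X β = ∑ Y ∈ N with Y.2 = β, nearK ϱ a b w X Y (ψ Y.1 Y.2 - ψ X.1 Y.2) := by
  rw [planarFlux, finsum_nearK_eq_sum hN β fun δ => ψ δ β - ψ X.1 β]
  exact sum_congr rfl fun Y hY => by rw [(mem_filter.mp hY).2]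

/-- ★ CHAIN / PLANAR SPLITTING: the site flux is the chain block (VI `chainK`) applied to the vertical increment `ψ X.1 β − ψ X` of the column of `X`
plus the planar flux (`ψ δ β − ψ X = (ψ X.1 β − ψ X) + (ψ δ β − ψ X.1 β)` bond by bond). [this file, g58] -/
theorem siteFlux_eq_chainK_add (hc : 0 < c) (hL : IsLayeredCrystal c a b w) (ϱ : ℝ) (ψ : Cell 2 → ℤ → E3) (X : Cell 2 × ℤ) (β : ℤ) :
    siteFlux ϱ a b w ψ X β = chainK ϱ a b w X β (ψ X.1 β - ψ X.1 X.2) + planarFlux ϱ a b w ψ X β := by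
  have hN := mem_nearFinset_of_le hc hL ϱ X
  rw [siteFlux_eq_sum hN, planarFlux_eq_sum hN, chainK_eq_sum hN, ← sum_add_distrib]
  refine sum_congr rfl fun Y hY => ?_
  rw [← nearK_add, (mem_filter.mp hY).2]
  congr 1
  abel

/-- ★ the truncated residual is the sum of the site fluxes over any finset of layers containing the layers of the near sites. [this file, g58] -/
theorem truncResidual_eq_sum_siteFlux (hc : 0 < c) (hL : IsLayeredCrystal c a b w) (ϱ : ℝ) (ψ : Cell 2 → ℤ → E3) (X : Cell 2 × ℤ) {S : Finset ℤ}
    (hS : ∀ Y : Cell 2 × ℤ, ‖lsite a b w Y.1 Y.2 - lsite a b w X.1 X.2‖ ≤ ϱ → Y.2 ∈ S) :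
    truncResidual ϱ a b w ψ X = ∑ β ∈ S, siteFlux ϱ a b w ψ X β := by
  have hN := mem_nearFinset_of_le hc hL ϱ X
  have hmaps : ∀ Y ∈ (finite_near_lsite hc hL X ϱ).toFinset, Y.2 ∈ S :=
    fun Y hY => hS Y ((finite_near_lsite hc hL X ϱ).mem_toFinset.mp hY)
  rw [truncResidual_eq_sum_nearK hN ψ, ← sum_fiberwise_of_maps_to (g := Prod.snd) hmaps]
  exact sum_congr rfl fun β _ => (siteFlux_eq_sum hN ψ β).symm

/-- the site flux is BANDED: in a `c`-co-Lipschitz crystal a layer farther than `ϱ / c` from the layer of `X` exerts no truncated force on `X`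
(VI `chainK_eq_zero_of_far` for the site flux). [this file, g58] -/
theorem siteFlux_eq_zero_of_far (hc : 0 < c) (hL : IsLayeredCrystal c a b w) {ϱ : ℝ} (ψ : Cell 2 → ℤ → E3) {X : Cell 2 × ℤ} {β : ℤ}
    (h : ϱ < c * |(((β - X.2 : ℤ)) : ℝ)|) : siteFlux ϱ a b w ψ X β = 0 := by
  unfold siteFlux
  refine (finsum_congr fun γ' => ?_).trans finsum_zero
  refine nearK_eq_zero_of_lt (X := X) (Y := (γ', β)) (h.trans_le ?_) _
  calc c * |(((β - X.2 : ℤ)) : ℝ)| ≤ c * dist X (γ', β) := mul_le_mul_of_nonneg_left (abs_snd_sub_le_dist X (γ', β)) hc.le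
    _ = c * dist (γ', β) X := by rw [dist_comm]
    _ ≤ ‖lsite a b w γ' β - lsite a b w X.1 X.2‖ := hL (γ', β) X

/-! ### WC.3  Cut sums and their increments -/

/-- the CUT SUM of a two-layer quantity `f α β` through the gap above layer `m`, carried by the layer set `T`: `Σ_{α ∈ T, α ≤ m} Σ_{β ∈ T, m < β} f α β`
(VO `chainFlux` is the cut sum of `chainK (0, α) β (cf β − cf α)`). [this file, g58] -/
def cutSum (T : Finset ℤ) (f : ℤ → ℤ → E3) (m : ℤ) : E3 :=
  ∑ α ∈ T with α ≤ m, ∑ β ∈ T with m < β, f α β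

/-- lowering the cut by one layer changes a cut sum by the outgoing minus the incoming terms of the layer `m ∈ T` (VO `chainFlux_sub_chainFlux`,
generic form). [formal bookkeeping] -/
theorem cutSum_sub_cutSum (T : Finset ℤ) (f : ℤ → ℤ → E3) {m : ℤ} (hm : m ∈ T) :
    cutSum T f m - cutSum T f (m - 1) = ∑ β ∈ T with m < β, f m β - ∑ α ∈ T with α < m, f α m := by
  have hm1 : m ∉ T.filter fun α => α < m := fun h => lt_irrefl m (mem_filter.mp h).2
  have hm2 : m ∉ T.filter fun β => m < β := fun h => lt_irrefl m (mem_filter.mp h).2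
  have e1 : cutSum T f m = (∑ β ∈ T with m < β, f m β) + ∑ α ∈ T with α < m, ∑ β ∈ T with m < β, f α β := by
    unfold cutSum
    rw [filter_le_eq_insert hm, sum_insert hm1]
  have e2 : cutSum T f (m - 1) = (∑ α ∈ T with α < m, f α m) + ∑ α ∈ T with α < m, ∑ β ∈ T with m < β, f α β := by
    unfold cutSum
    rw [filter_le_pred_eq, filter_pred_lt_eq_insert hm, ← sum_add_distrib]
    exact sum_congr rfl fun α _ => sum_insert hm2
  rw [e1, e2, add_sub_add_right_eq_sub]

/-- splitting a sum over `T ∋ m` into the layers below `m`, the layer `m`, and the layers above. [formal bookkeeping] -/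
theorem sum_eq_sum_lt_add_add_sum_gt {T : Finset ℤ} {m : ℤ} (hm : m ∈ T) (s : ℤ → E3) :
    ∑ β ∈ T, s β = (∑ β ∈ T with β < m, s β) + s m + ∑ β ∈ T with m < β, s β := by
  rw [← sum_filter_add_sum_filter_not T (fun β => β < m) s]
  have hge : (T.filter fun β => ¬β < m) = insert m (T.filter fun β => m < β) := by
    ext β
    simp only [mem_filter, mem_insert, not_lt]
    constructor
    · rintro ⟨hT, h⟩
      rcases h.lt_or_eq with h' | h'
      · exact Or.inr ⟨hT, h'⟩
      · exact Or.inl h'.symm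
    · rintro (rfl | ⟨hT, h⟩)
      · exact ⟨hm, le_rfl⟩
      · exact ⟨hT, h.le⟩
  have hm2 : m ∉ T.filter fun β => m < β := fun h => lt_irrefl m (mem_filter.mp h).2
  rw [hge, sum_insert hm2, add_assoc]

/-! ### WC.4  The column flux -/

/-- the COLUMN FLUX through the gap above layer `m` received by the column `γ`: `Σ_{α ∈ T, α ≤ m} Σ_{β ∈ T, m < β} siteFlux ψ (γ, α) β` — the total
linearised force exerted by the layers above the cut on the sites of the column below it. [this file, g58] -/
def colFlux (ϱ : ℝ) (a b : E3) (w : ℤ → E3) (T : Finset ℤ) (ψ : Cell 2 → ℤ → E3) (γ : Cell 2) (m : ℤ) : E3 :=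
  cutSum T (fun α β => siteFlux ϱ a b w ψ (γ, α) β) m

/-- the PLANAR part of the column flux: the cut sum of the planar fluxes of the column. [this file, g58] -/
def colPlanar (ϱ : ℝ) (a b : E3) (w : ℤ → E3) (T : Finset ℤ) (ψ : Cell 2 → ℤ → E3) (γ : Cell 2) (m : ℤ) : E3 :=
  cutSum T (fun α β => planarFlux ϱ a b w ψ (γ, α) β) m

/-- ★ the column flux is VO's chain flux of the COLUMN PROFILE `ψ γ` plus the planar part (`siteFlux_eq_chainK_add` and the in-plane translation
invariance VI `chainK_translate` of the chain blocks). [this file, g58] -/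
theorem colFlux_eq_chainFlux_add (hc : 0 < c) (hL : IsLayeredCrystal c a b w) (ϱ : ℝ) (T : Finset ℤ) (ψ : Cell 2 → ℤ → E3) (γ : Cell 2) (m : ℤ) :
    colFlux ϱ a b w T ψ γ m = chainFlux ϱ a b w T (ψ γ) m + colPlanar ϱ a b w T ψ γ m := by
  unfold colFlux colPlanar cutSum chainFlux
  rw [← sum_add_distrib]
  refine sum_congr rfl fun α _ => ?_
  rw [← sum_add_distrib]
  refine sum_congr rfl fun β _ => ?_
  beta_reduce
  rw [siteFlux_eq_chainK_add hc hL, chainK_translate]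

/-- ★★ THE INCREMENT FORM OF THE COLUMN FLUX: for every carrier containing the band box `[m − r, m + 1 + r]` (`r = ⌊ϱ/c⌋₊`) the column flux is VP's
banded block operator applied to the column's nearest-layer increments `k ↦ ψ γ (k+1) − ψ γ k` (VM `blockApply`), plus the planar part
(VP `chainFlux_eq_sum_fluxBlock`). [this file, g58] -/
theorem colFlux_eq_blockApply_add (hc : 0 < c) (hL : IsLayeredCrystal c a b w) {ϱ : ℝ} {T : Finset ℤ} (ψ : Cell 2 → ℤ → E3) (γ : Cell 2) {m : ℤ}
    (hT : Icc (m - ⌊ϱ / c⌋₊) (m + 1 + ⌊ϱ / c⌋₊) ⊆ T) :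
    colFlux ϱ a b w T ψ γ m =
      blockApply (fluxBlock hc hL ϱ) (Icc (m - ⌊ϱ / c⌋₊) (m + ⌊ϱ / c⌋₊)) (fun k => ψ γ (k + 1) - ψ γ k) m + colPlanar ϱ a b w T ψ γ m := by
  rw [colFlux_eq_chainFlux_add hc hL, chainFlux_eq_sum_fluxBlock hc hL (ψ γ) hT]
  rfl

/-! ### WC.5  ★ The divergence identity of a harmonic column -/

/-- ★★★ THE DIVERGENCE IDENTITY: if `ψ` is `ϱ`-truncated harmonic at the site `(γ, m)` (vanishing truncated residual) then lowering the cut from `m` to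
`m − 1` changes the column flux of the column `γ` by
`−Σ_{β ∈ T, β < m} (siteFlux ψ (γ,m) β + siteFlux ψ (γ,β) m) − siteFlux ψ (γ,m) m`
(for every carrier `T ∋ m` containing the layers of the near sites of `(γ, m)`): the outgoing terms `Σ_{β > m} siteFlux ψ (γ,m) β` of `cutSum_sub_cutSum`
are minus the rest of the residual. For a layer-only field every summand on the right vanishes (VO `chainFlux_sub_chainFlux`, flux conservation); in general
they are parallelogram and second in-plane differences (WC.6). [this file, g58] -/
theorem colFlux_sub_colFlux_of_residual (hc : 0 < c) (hL : IsLayeredCrystal c a b w) {ϱ : ℝ} (ψ : Cell 2 → ℤ → E3) {T : Finset ℤ} {γ : Cell 2} {m : ℤ}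
    (hm : m ∈ T) (hS : ∀ Y : Cell 2 × ℤ, ‖lsite a b w Y.1 Y.2 - lsite a b w γ m‖ ≤ ϱ → Y.2 ∈ T) (hres : truncResidual ϱ a b w ψ (γ, m) = 0) :
    colFlux ϱ a b w T ψ γ m - colFlux ϱ a b w T ψ γ (m - 1) =
      -(∑ β ∈ T with β < m, (siteFlux ϱ a b w ψ (γ, m) β + siteFlux ϱ a b w ψ (γ, β) m)) - siteFlux ϱ a b w ψ (γ, m) m := by
  have h0 : ∑ β ∈ T, siteFlux ϱ a b w ψ (γ, m) β = 0 := by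
    rw [← truncResidual_eq_sum_siteFlux hc hL ϱ ψ (γ, m) hS]
    exact hres
  have h3 := sum_eq_sum_lt_add_add_sum_gt hm fun β => siteFlux ϱ a b w ψ (γ, m) β
  have hB : ∑ β ∈ T with m < β, siteFlux ϱ a b w ψ (γ, m) β =
      -((∑ β ∈ T with β < m, siteFlux ϱ a b w ψ (γ, m) β) + siteFlux ϱ a b w ψ (γ, m) m) :=
    eq_neg_of_add_eq_zero_right (h3.symm.trans h0)
  unfold colFlux
  rw [cutSum_sub_cutSum T _ hm]
  beta_reduce
  rw [hB, sum_add_distrib]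
  abel

/-! ### WC.6  Bond reversal and point reflection: the pair terms as parallelogram and second differences -/

/-- ★ REFLECTED FORM of the incoming flux: the force exerted on the site `(γ, β)` by the layer `m` equals, bond by bond, the truncated kernel FROM `(γ, m)`
into the layer `β` applied to `ψ (2γ − δ) m − ψ γ β` (bond reversal UT `nearK_comm` and the in-plane translation invariance VI `nearK_translate`, re-indexed by
the point reflection `δ ↦ 2γ − δ` of the plane about the column). [this file, g58] -/
theorem siteFlux_reflect (ϱ : ℝ) (a b : E3) (w : ℤ → E3) (ψ : Cell 2 → ℤ → E3) (γ : Cell 2) (β m : ℤ) :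
    siteFlux ϱ a b w ψ (γ, β) m = ∑ᶠ δ : Cell 2, nearK ϱ a b w (γ, m) (δ, β) (ψ (γ + γ - δ) m - ψ γ β) := by
  rw [siteFlux, ← finsum_comp_equiv (Equiv.subLeft (γ + γ)) (f := fun δ : Cell 2 => nearK ϱ a b w (γ, m) (δ, β) (ψ (γ + γ - δ) m - ψ γ β))]
  refine finsum_congr fun γ' => ?_
  dsimp only
  rw [Equiv.subLeft_apply, sub_sub_cancel, ← nearK_comm ϱ a b w (γ, β) (γ', m), nearK_translate ϱ a b w γ' γ m β,
    nearK_translate ϱ a b w γ (γ + γ - γ') m β, show γ + γ - γ' - γ = γ - γ' from by abel]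

/-- ★ THE PAIR TERM of the divergence identity as ONE finite sum of truncated bonds from `(γ, m)` into the layer `β`, each applied to a PARALLELOGRAM
difference `(ψ δ β − ψ γ β) − (ψ δ m − ψ γ m)` (a mixed vertical / in-plane second difference) plus an in-plane SECOND difference
`ψ δ m + ψ (2γ − δ) m − 2 ψ γ m` of the layer `m` (`siteFlux_eq_sum` + `siteFlux_reflect`). [this file, g58] -/
theorem siteFlux_add_siteFlux_eq_sum {ϱ : ℝ} {γ : Cell 2} {m : ℤ} {N : Finset (Cell 2 × ℤ)}
    (hN : ∀ Y : Cell 2 × ℤ, ‖lsite a b w Y.1 Y.2 - lsite a b w γ m‖ ≤ ϱ → Y ∈ N) (ψ : Cell 2 → ℤ → E3) (β : ℤ) :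
    siteFlux ϱ a b w ψ (γ, m) β + siteFlux ϱ a b w ψ (γ, β) m =
      ∑ Y ∈ N with Y.2 = β, nearK ϱ a b w (γ, m) Y
        (((ψ Y.1 β - ψ γ β) - (ψ Y.1 m - ψ γ m)) + (ψ Y.1 m + ψ (γ + γ - Y.1) m - (ψ γ m + ψ γ m))) := by
  rw [siteFlux_eq_sum (X := (γ, m)) hN ψ β, siteFlux_reflect, finsum_nearK_eq_sum (X := (γ, m)) hN β fun δ => ψ (γ + γ - δ) m - ψ γ β,
    ← sum_add_distrib]
  refine sum_congr rfl fun Y hY => ?_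
  rw [← nearK_add, (mem_filter.mp hY).2]
  congr 1
  abel

/-- ★ the SAME-LAYER term symmetrised: twice the force exerted on `(γ, m)` by its own layer is the sum of the truncated in-plane bonds applied to the
in-plane SECOND differences `ψ δ m + ψ (2γ − δ) m − 2 ψ γ m`. [this file, g58] -/
theorem two_smul_siteFlux_self_eq_sum {ϱ : ℝ} {γ : Cell 2} {m : ℤ} {N : Finset (Cell 2 × ℤ)}
    (hN : ∀ Y : Cell 2 × ℤ, ‖lsite a b w Y.1 Y.2 - lsite a b w γ m‖ ≤ ϱ → Y ∈ N) (ψ : Cell 2 → ℤ → E3) :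
    (2 : ℝ) • siteFlux ϱ a b w ψ (γ, m) m = ∑ Y ∈ N with Y.2 = m, nearK ϱ a b w (γ, m) Y (ψ Y.1 m + ψ (γ + γ - Y.1) m - (ψ γ m + ψ γ m)) := by
  rw [two_smul]
  nth_rewrite 2 [siteFlux_reflect]
  rw [siteFlux_eq_sum (X := (γ, m)) hN ψ m, finsum_nearK_eq_sum (X := (γ, m)) hN m fun δ => ψ (γ + γ - δ) m - ψ γ m, ← sum_add_distrib]
  refine sum_congr rfl fun Y hY => ?_
  rw [← nearK_add, (mem_filter.mp hY).2]
  congr 1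
  abel

/-! ### WC.7  The closed statement of this part -/

/-- The content of part WC as one closed proposition: the banded site flux, the increment form of the column flux, the divergence identity of the
column flux of a field harmonic at a site, and the pair / same-layer terms as parallelogram and second in-plane differences. -/
def ColumnFluxShape : Prop :=
  ∀ c : ℝ, 0 < c → ∀ (a b : E3) (w : ℤ → E3) (hL : IsLayeredCrystal c a b w) (ϱ : ℝ) (ψ : Cell 2 → ℤ → E3) (T : Finset ℤ) (γ : Cell 2) (m : ℤ)
    (hc : 0 < c),
    (∀ β : ℤ, ϱ < c * |(((β - m : ℤ)) : ℝ)| → siteFlux ϱ a b w ψ (γ, m) β = 0) ∧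
    (Icc (m - ⌊ϱ / c⌋₊) (m + 1 + ⌊ϱ / c⌋₊) ⊆ T → colFlux ϱ a b w T ψ γ m =
      blockApply (fluxBlock hc hL ϱ) (Icc (m - ⌊ϱ / c⌋₊) (m + ⌊ϱ / c⌋₊)) (fun k => ψ γ (k + 1) - ψ γ k) m + colPlanar ϱ a b w T ψ γ m) ∧
    (m ∈ T → (∀ Y : Cell 2 × ℤ, ‖lsite a b w Y.1 Y.2 - lsite a b w γ m‖ ≤ ϱ → Y.2 ∈ T) → truncResidual ϱ a b w ψ (γ, m) = 0 →
      colFlux ϱ a b w T ψ γ m - colFlux ϱ a b w T ψ γ (m - 1) =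
        -(∑ β ∈ T with β < m, (siteFlux ϱ a b w ψ (γ, m) β + siteFlux ϱ a b w ψ (γ, β) m)) - siteFlux ϱ a b w ψ (γ, m) m) ∧
    ∀ N : Finset (Cell 2 × ℤ), (∀ Y : Cell 2 × ℤ, ‖lsite a b w Y.1 Y.2 - lsite a b w γ m‖ ≤ ϱ → Y ∈ N) →
      (∀ β : ℤ, siteFlux ϱ a b w ψ (γ, m) β + siteFlux ϱ a b w ψ (γ, β) m =
        ∑ Y ∈ N with Y.2 = β, nearK ϱ a b w (γ, m) Y
          (((ψ Y.1 β - ψ γ β) - (ψ Y.1 m - ψ γ m)) + (ψ Y.1 m + ψ (γ + γ - Y.1) m - (ψ γ m + ψ γ m)))) ∧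
      (2 : ℝ) • siteFlux ϱ a b w ψ (γ, m) m = ∑ Y ∈ N with Y.2 = m, nearK ϱ a b w (γ, m) Y (ψ Y.1 m + ψ (γ + γ - Y.1) m - (ψ γ m + ψ γ m))

/-- WC holds. [this file, g58] -/
theorem columnFluxShape_holds : ColumnFluxShape :=
  fun _c _hc0 _a _b _w hL _ϱ ψ _T γ _m hc =>
    ⟨fun _β hβ => siteFlux_eq_zero_of_far hc hL ψ (X := (γ, _m)) hβ, fun hT => colFlux_eq_blockApply_add hc hL ψ γ hT,
      fun hm hS hres => colFlux_sub_colFlux_of_residual hc hL ψ hm hS hres,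
      fun _N hN => ⟨fun β => siteFlux_add_siteFlux_eq_sum hN ψ β, two_smul_siteFlux_self_eq_sum hN ψ⟩⟩

end ColumnFlux

end Summit.AtomisticToContinuum.Crystallization.Theorems.ChartedZeroExcessLayeredLatticeLiouville
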